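import Literature.Geometry.Manifold.WhitneyApproximation
import Literature.AlgebraicTopology.SingularHomology.SphereCylinderCohomology
import HarnessLib

/-!
# Smoothing a collapse map into the punctured Euclidean space

For a σ-compact `E`-manifold `U` and a continuous `γ : U → ℝᵏ ∪ {∞}` there is a `C^∞` map
`G : U → ℝᵏ⁺¹` avoiding the origin such that the induced map `U → ℝᵏ⁺¹ ∖ {0}` detects in homology
every class that `γ` detects: Whitney-approximate `θ ∘ γ : U → Sᵏ` (`θ : ℝᵏ ∪ {∞} ≃ Sᵏ`,
Lee (2013), Thm. 6.26) by a smooth map `G₀` homotopic to it and let `G = G₀` followed by the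
inclusion of the sphere; the radial retraction `ℝᵏ⁺¹ ∖ {0} → Sᵏ` is a left inverse of the inclusion,
so nothing detected by `G₀` is lost (`exists_contMDiff_punctured_detect`).

Everything is proved; no named facts.

## References

* [LeeSmoothManifolds2013] J. M. Lee, *Introduction to Smooth Manifolds*, 2nd ed., Thm. 6.26.
* [HatcherAT2002] A. Hatcher, *Algebraic Topology*, CUP 2002, Cor. 2.11.
-/

noncomputable section

open scoped Manifold ContDiff Topology
open CategoryTheory Set Function
open Literature.AlgebraicTopology.SingularHomology

namespace Literature.Geometry.Manifold

variable {E : Type} [NormedAddCommGroup E] [NormedSpace ℝ E] [FiniteDimensional ℝ E] (F : Type) [Field F]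

/-- The punctured Euclidean space `ℝᵐ ∖ {0}`. [folklore] -/
abbrev puncturedSet (m : ℕ) : Set (EuclideanSpace ℝ (Fin m)) := {x | x ≠ 0}

/-- The inclusion of the unit sphere into the punctured space. [folklore] -/
def sphereToPunctured (k : ℕ) : C(↥(unitSphere (k + 1)), ↥(puncturedSet (k + 1))) :=
  ⟨fun x ↦ ⟨x.1, fun h0 ↦ by
    have hx : ‖(x : EuclideanSpace ℝ (Fin (k + 1)))‖ = 1 := mem_sphere_zero_iff_norm.1 x.2
    rw [show (x : EuclideanSpace ℝ (Fin (k + 1))) = 0 from h0, norm_zero] at hx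
    exact zero_ne_one hx⟩, continuous_subtype_val.subtype_mk _⟩

/-- The radial retraction `ℝᵏ⁺¹ ∖ {0} → Sᵏ`, `x ↦ x / ‖x‖`. [folklore] -/
def puncturedToSphere (k : ℕ) : C(↥(puncturedSet (k + 1)), ↥(unitSphere (k + 1))) :=
  ⟨fun x ↦ ⟨‖(x : EuclideanSpace ℝ (Fin (k + 1)))‖⁻¹ • (x : EuclideanSpace ℝ (Fin (k + 1))), by
    have hx : (x : EuclideanSpace ℝ (Fin (k + 1))) ≠ 0 := x.2
    simp [norm_smul, norm_ne_zero_iff.2 hx]⟩, by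
    have h1 : Continuous fun x : ↥(puncturedSet (k + 1)) ↦ (x : EuclideanSpace ℝ (Fin (k + 1))) := continuous_subtype_val
    have h2 : Continuous fun x : ↥(puncturedSet (k + 1)) ↦ ‖(x : EuclideanSpace ℝ (Fin (k + 1)))‖⁻¹ :=
      h1.norm.inv₀ fun x ↦ norm_ne_zero_iff.2 x.2
    exact (h2.smul h1).subtype_mk _⟩

/-- The retraction is a left inverse of the inclusion. [folklore] -/
theorem puncturedToSphere_comp_sphereToPunctured (k : ℕ) :
    (puncturedToSphere k).comp (sphereToPunctured k) = ContinuousMap.id _ := by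
  ext x
  have hx : ‖(x : EuclideanSpace ℝ (Fin (k + 1)))‖ = 1 := mem_sphere_zero_iff_norm.1 x.2
  change (‖(x : EuclideanSpace ℝ (Fin (k + 1)))‖⁻¹ • (x : EuclideanSpace ℝ (Fin (k + 1)))) _ = _
  rw [hx, inv_one, one_smul]
  rfl

/-- **Smoothing the collapse map into the punctured Euclidean space.** For a σ-compact Hausdorff
`E`-manifold `U` and a continuous `γ : U → ℝᵏ ∪ {∞}` there is a `C^∞` map `G : U → ℝᵏ⁺¹ ∖ {0}`
(valued in the unit sphere) such that `G_* σ ≠ 0` in `H_n(ℝᵏ⁺¹ ∖ {0}; F)` whenever `γ_* σ ≠ 0`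
(`σ ∈ H_n(U; F)`): Whitney approximation of `θ ∘ γ : U → Sᵏ` and the radial retraction.
[cite: LeeSmoothManifolds2013, Thm. 6.26] [cite: HatcherAT2002, Cor. 2.11] -/
theorem exists_contMDiff_punctured_detect {k : ℕ} (U : Type) [TopologicalSpace U] [ChartedSpace E U]
    [IsManifold 𝓘(ℝ, E) ∞ U] [SigmaCompactSpace U] [T2Space U] (γ : C(U, OnePoint (EuclideanSpace ℝ (Fin k)))) :
    ∃ (G : U → EuclideanSpace ℝ (Fin (k + 1)))
      (hG : ContMDiff 𝓘(ℝ, E) 𝓘(ℝ, EuclideanSpace ℝ (Fin (k + 1))) ∞ G)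
      (hG0 : ∀ u, G u ∈ puncturedSet (k + 1)),
      ∀ (n : ℕ) (σ : singularHomology F F U n), singularHomology.map F F γ n σ ≠ 0 →
        singularHomology.map F F
          (⟨fun u ↦ ⟨G u, hG0 u⟩, hG.continuous.subtype_mk _⟩ : C(U, ↥(puncturedSet (k + 1)))) n σ ≠ 0 := by
  haveI : Fact (Module.finrank ℝ (EuclideanSpace ℝ (Fin (k + 1))) = k + 1) := ⟨finrank_euclideanSpace_fin⟩
  -- Whitney approximation of `θ ∘ γ : U → Sᵏ`
  obtain ⟨G₀, hG₀, hhom⟩ := exists_contMDiff_homotopic (IM := 𝓘(ℝ, E)) (IN := 𝓡 k)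
    ((⟨onePointHomeomorphUnitSphere k, (onePointHomeomorphUnitSphere k).continuous⟩ :
      C(OnePoint (EuclideanSpace ℝ (Fin k)), ↥(unitSphere (k + 1)))).comp γ)
  have hval : ContMDiff (𝓡 k) 𝓘(ℝ, EuclideanSpace ℝ (Fin (k + 1))) ∞
      (Subtype.val : ↥(unitSphere (k + 1)) → EuclideanSpace ℝ (Fin (k + 1))) := contMDiff_coe_sphere
  refine ⟨fun u ↦ (G₀ u : EuclideanSpace ℝ (Fin (k + 1))), hval.comp hG₀, fun u ↦ (sphereToPunctured k (G₀ u)).2,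
    fun n σ hσ h0 ↦ ?_⟩
  -- the induced map to the punctured space is `sphereToPunctured ∘ G₀`
  have hfac : (⟨fun u ↦ ⟨(G₀ u : EuclideanSpace ℝ (Fin (k + 1))), (sphereToPunctured k (G₀ u)).2⟩,
      (hval.comp hG₀).continuous.subtype_mk _⟩ : C(U, ↥(puncturedSet (k + 1)))) = (sphereToPunctured k).comp G₀ := by
    ext u
    rfl
  rw [hfac] at h0
  -- retract to the sphere: `G₀_* σ = 0`
  have h1 : singularHomology.map F F G₀ n σ = 0 := by
    have := congrArg (singularHomology.map F F (puncturedToSphere k) n) h0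
    rw [map_zero, ← ModuleCat.comp_apply, ← singularHomology.map_comp, ← ContinuousMap.comp_assoc,
      puncturedToSphere_comp_sphereToPunctured, ContinuousMap.id_comp] at this
    exact this
  -- but `G₀ ≃ θ ∘ γ` and `θ_*` is injective
  rw [singularHomology.map_eq_of_homotopic F F hhom.symm, singularHomology.map_comp, ModuleCat.comp_apply] at h1
  exact hσ (injective_map_homeomorph F F (onePointHomeomorphUnitSphere k) n (h1.trans (map_zero _).symm))

end Literature.Geometry.Manifold
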